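import Literature.AlgebraicGeometry.Resolution.QuasiProjectiveResolution
import Literature.AlgebraicGeometry.Resolution.ProjectiveSpaceRegular
import Literature.AlgebraicGeometry.Motives.VarietiesProperProofs
import HarnessLib

/-!
# Resolution of singularities: reduction to integral quasi-projective schemes (any field)

Topic: `Literature/AlgebraicGeometry/Resolution`. Characteristic-free glue shared by the routes
`ResolutionOfSingularities/WeightedInvariant` (item `DatumToResolution`, stmt-8974) and
`ResolutionOfSingularities/UniformComplexity` (item `EmbeddedToNonembedded`, stmt-0573): over a
FIXED field `k` (any characteristic, perfect or not), resolution of singularities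
(`Scheme.HasResolution`: a proper birational morphism from a regular scheme) for every reduced
separated `k`-scheme of finite type follows from resolution of the INTEGRAL schemes admitting an
immersion into some projective space `𝐏ⁿ_k` — equivalently, of the integral closed subschemes of
the open subschemes of the `𝐏ⁿ_k`.

Proof (all ingredients are in the tree): resolve the irreducible components with their integral
structure and glue (`hasResolution_of_forall_closeds`, Cossart–Piltant 2019, proof of Prop. 4.6,
Step 1); for an integral `Z`, Chow's lemma (`ChowLemmaIntegral_holds`, Görtz–Wedhorn Thm. 13.100)
gives a proper birational `π : Z' → Z` from an integral `Z'` with an immersion `ι : Z' → 𝐏ⁿ_k`; a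
resolution of `Z'` composed with `π` resolves `Z` (`Scheme.HasResolution.of_isBirational`). An
immersion factors as a closed immersion into the open subscheme `ι.coborderRange` (Mathlib
`Scheme.Hom.liftCoborder`), and the opens of `𝐏ⁿ_k` are smooth, separated and quasi-compact over
`k` (`𝐏ⁿ_k → Spec k` is smooth and proper: `Motives.isSmoothProjective_projectiveSpace_holds`,
`Motives.isProper_projectiveSpace`; `𝐏ⁿ_k` is Noetherian) and regular (`isRegular_projectiveSpace`).
This is the argument of `Kollar2007QuasiProjectiveResolution.integralResolutionInChar_zero`
(`QuasiProjectiveResolution.lean`, characteristic zero, named-fact form) run over an arbitrary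
field with the quasi-projective case as a hypothesis.

## Contents

* `hasResolution_of_forall_immersion_projectiveSpace` — hypothesis: every integral `X` with an
  immersion into some `𝐏ⁿ_k` has a resolution.
* `hasResolution_of_forall_closedImmersion_opens_projectiveSpace` — hypothesis: every integral
  closed subscheme of every open subscheme of every `𝐏ⁿ_k` has a resolution.
* `hasResolution_of_forall_closedImmersion_smooth` — hypothesis: every integral closed subscheme of
  every smooth separated quasi-compact `k`-scheme has a resolution (the antecedent shape of
  `WeightedInvariant.DatumToEmbedded`).
* `hasResolution_of_forall_closedImmersion_regular` — hypothesis: every integral closed subscheme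
  of every regular separated `k`-scheme of finite type has a resolution (the antecedent shape of
  `UniformComplexity.EmbeddedToNonembedded`).
* `resolutionInChar_iff_forall_immersion_projectiveSpace` — `ResolutionInChar p` is equivalent to
  its integral quasi-projective case.

## Sources

* J. Kollár, *Lectures on Resolution of Singularities*, Ann. of Math. Stud. 166 (2007), proof of
  Thm. 3.36 from Cor. 3.22 / Prop. 3.37 (reduction to the quasi-projective case). [Kollar2007]
* U. Görtz, T. Wedhorn, *Algebraic Geometry I*, 2nd ed. (2020), Thm. 13.100 (Chow's lemma).
  [GortzWedhorn2020]
* V. Cossart, O. Piltant, J. Algebra 529 (2019), proof of Prop. 4.6, Step 1 (components).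
  [CossartPiltant2019]
-/

noncomputable section

open CategoryTheory AlgebraicGeometry TopologicalSpace

namespace Literature.AlgebraicGeometry.Resolution

universe u

variable {k : Type u} [Field k]

open Scheme.IdealSheafData

/-- **Resolution reduces to integral quasi-projective schemes** (over a fixed field `k`, any
characteristic): if every integral scheme `X` admitting an immersion `ι : X → 𝐏ⁿ_k` into some
projective space has a resolution of singularities, then so does every reduced separated
`k`-scheme of finite type. Components (`hasResolution_of_forall_closeds`) + Chow's lemma
(`ChowLemmaIntegral_holds`) + transport along proper birational morphisms
(`Scheme.HasResolution.of_isBirational`). [cite: Kollar2007, Thm. 3.36 from Cor. 3.22 (pp. 124, 132)] -/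
theorem hasResolution_of_forall_immersion_projectiveSpace
    (h : ∀ (n : ℕ) (X : Scheme.{u}) (ι : X ⟶ (Motives.projectiveSpace n k).left),
      IsImmersion ι → IsIntegral X → Scheme.HasResolution X)
    (X : Scheme.{u}) (f : X ⟶ Spec (.of k)) [IsSeparated f] [LocallyOfFiniteType f]
    [QuasiCompact f] [IsReduced X] : Scheme.HasResolution X := by
  refine hasResolution_of_forall_closeds X f fun Z hZ => ?_
  haveI := hZ
  obtain ⟨n, X', π, ι, hint', hι, hπ, -, -, U, hU, hU', hiso⟩ :=
    ChowLemmaIntegral_holds k _ ((vanishingIdeal Z).subschemeι ≫ f) inferInstance inferInstance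
      inferInstance hZ
  haveI := hπ
  exact Scheme.HasResolution.of_isBirational π ⟨U, hU, hU', hiso⟩ (h n X' ι hι hint')

/-- **Resolution reduces to integral closed subschemes of quasi-projective smooth ambients**: if
every integral closed subscheme `X` of every open subscheme `U ⊆ 𝐏ⁿ_k` has a resolution, then so
does every reduced separated `k`-scheme of finite type (an immersion `X → 𝐏ⁿ_k` is a closed
immersion into the open `coborderRange`, Mathlib `Scheme.Hom.liftCoborder`).
[cite: Kollar2007, Thm. 3.36 from Cor. 3.22 (pp. 124, 132)] -/
theorem hasResolution_of_forall_closedImmersion_opens_projectiveSpace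
    (h : ∀ (n : ℕ) (U : (Motives.projectiveSpace n k).left.Opens) (X : Scheme.{u})
      (i : X ⟶ (U : Scheme.{u})), IsClosedImmersion i → IsIntegral X → Scheme.HasResolution X)
    (X : Scheme.{u}) (f : X ⟶ Spec (.of k)) [IsSeparated f] [LocallyOfFiniteType f]
    [QuasiCompact f] [IsReduced X] : Scheme.HasResolution X := by
  refine hasResolution_of_forall_immersion_projectiveSpace (fun n X' ι hι hint' => ?_) X f
  haveI := hι
  exact h n ι.coborderRange X' ι.liftCoborder inferInstance hint'

omit [Field k] in
/-- The structure morphism `U ⊆ 𝐏ⁿ_k → Spec k` of an open subscheme of projective space is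
smooth, separated and quasi-compact, and `U` is regular (`𝐏ⁿ_k → Spec k` is smooth and proper,
`Motives.isSmoothProjective_projectiveSpace_holds`, `Motives.isProper_projectiveSpace`; `𝐏ⁿ_k` is
Noetherian and regular, `isRegular_projectiveSpace`). [folklore] -/
theorem smooth_isSeparated_quasiCompact_isRegular_opens_projectiveSpace [Field k] (n : ℕ)
    (U : (Motives.projectiveSpace n k).left.Opens) :
    Smooth (U.ι ≫ (Motives.projectiveSpace n k).hom) ∧
      IsSeparated (U.ι ≫ (Motives.projectiveSpace n k).hom) ∧
        QuasiCompact (U.ι ≫ (Motives.projectiveSpace n k).hom) ∧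
          Scheme.IsRegular (U : Scheme.{u}) := by
  haveI : IsProper (Motives.projectiveSpace n k).hom := Motives.isProper_projectiveSpace n k
  haveI : Smooth (Motives.projectiveSpace n k).hom :=
    (Motives.isSmoothProjective_projectiveSpace_holds k n).smoothOfRelativeDimension.smooth
  haveI : IsLocallyNoetherian (Motives.projectiveSpace n k).left :=
    LocallyOfFiniteType.isLocallyNoetherian (Motives.projectiveSpace n k).hom
  haveI : CompactSpace (Motives.projectiveSpace n k).left :=
    QuasiCompact.compactSpace_of_compactSpace (Motives.projectiveSpace n k).hom
  haveI : IsNoetherian (Motives.projectiveSpace n k).left := {}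
  haveI : NoetherianSpace (U : Scheme.{u}) := U.ι.isOpenEmbedding.isInducing.noetherianSpace
  refine ⟨inferInstance, inferInstance, inferInstance, fun u => ?_⟩
  haveI := isRegular_projectiveSpace (n := n) (k := k) (U.ι u)
  exact IsRegularLocalRing.of_ringEquiv (asIso (U.ι.stalkMap u)).commRingCatIsoToRingEquiv

/-- **Embedded resolution in smooth ambients suffices**: over a field `k`, if every integral
closed subscheme `i : X → Y` of every smooth, separated, quasi-compact `k`-scheme `g : Y → Spec k`
has a resolution of singularities, then so does every reduced separated `k`-scheme of finite type
(the antecedent shape of route item `WeightedInvariant.DatumToEmbedded`).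
[cite: Kollar2007, Thm. 3.36 from Cor. 3.22 (pp. 124, 132)] -/
theorem hasResolution_of_forall_closedImmersion_smooth
    (h : ∀ (Y X : Scheme.{u}) (g : Y ⟶ Spec (.of k)) (i : X ⟶ Y),
      Smooth g → IsSeparated g → QuasiCompact g → IsClosedImmersion i → IsIntegral X →
        Scheme.HasResolution X)
    (X : Scheme.{u}) (f : X ⟶ Spec (.of k)) [IsSeparated f] [LocallyOfFiniteType f]
    [QuasiCompact f] [IsReduced X] : Scheme.HasResolution X := by
  refine hasResolution_of_forall_closedImmersion_opens_projectiveSpace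
    (fun n U X' i hi hint' => ?_) X f
  obtain ⟨hs, hsep, hqc, -⟩ := smooth_isSeparated_quasiCompact_isRegular_opens_projectiveSpace n U
  exact h U X' (U.ι ≫ (Motives.projectiveSpace n k).hom) i hs hsep hqc hi hint'

/-- **Embedded resolution in regular ambients suffices**: over a field `k`, if every integral
closed subscheme `i : X → Y` of every regular, separated `k`-scheme of finite type
`g : Y → Spec k` has a resolution of singularities, then so does every reduced separated
`k`-scheme of finite type (the antecedent shape of route item
`UniformComplexity.EmbeddedToNonembedded`). [cite: Kollar2007, Thm. 3.36 from Cor. 3.22 (pp. 124, 132)] -/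
theorem hasResolution_of_forall_closedImmersion_regular
    (h : ∀ (Y X : Scheme.{u}) (g : Y ⟶ Spec (.of k)) (i : X ⟶ Y),
      IsSeparated g → LocallyOfFiniteType g → QuasiCompact g → Scheme.IsRegular Y →
        IsClosedImmersion i → IsIntegral X → Scheme.HasResolution X)
    (X : Scheme.{u}) (f : X ⟶ Spec (.of k)) [IsSeparated f] [LocallyOfFiniteType f]
    [QuasiCompact f] [IsReduced X] : Scheme.HasResolution X := by
  refine hasResolution_of_forall_closedImmersion_opens_projectiveSpace
    (fun n U X' i hi hint' => ?_) X f
  obtain ⟨hs, hsep, hqc, hreg⟩ :=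
    smooth_isSeparated_quasiCompact_isRegular_opens_projectiveSpace n U
  haveI := hs
  exact h U X' (U.ι ≫ (Motives.projectiveSpace n k).hom) i hsep inferInstance hqc hreg hi hint'

/-- **`ResolutionInChar p` is equivalent to its integral quasi-projective case**: resolution of
every reduced separated scheme of finite type over every field of characteristic `p` holds iff
every integral scheme immersed in some `𝐏ⁿ_k`, `k` of characteristic `p`, has a resolution (such a
scheme is reduced, separated and of finite type over `k`: `𝐏ⁿ_k → Spec k` is proper,
`Motives.isProper_projectiveSpace`, and a subspace of the Noetherian `𝐏ⁿ_k` is Noetherian).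
[cite: Kollar2007, Thm. 3.36 from Cor. 3.22 (pp. 124, 132)] -/
theorem resolutionInChar_iff_forall_immersion_projectiveSpace (p : ℕ) :
    ResolutionInChar.{u} p ↔
      ∀ (k : Type u) [Field k] [CharP k p] (n : ℕ) (X : Scheme.{u})
        (ι : X ⟶ (Motives.projectiveSpace n k).left),
        IsImmersion ι → IsIntegral X → Scheme.HasResolution X := by
  constructor
  · intro h k _ _ n X ι hι hint
    haveI := hι
    haveI := hint
    haveI : IsProper (Motives.projectiveSpace n k).hom := Motives.isProper_projectiveSpace n k
    haveI : IsLocallyNoetherian (Motives.projectiveSpace n k).left :=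
      LocallyOfFiniteType.isLocallyNoetherian (Motives.projectiveSpace n k).hom
    haveI : CompactSpace (Motives.projectiveSpace n k).left :=
      QuasiCompact.compactSpace_of_compactSpace (Motives.projectiveSpace n k).hom
    haveI : IsNoetherian (Motives.projectiveSpace n k).left := {}
    haveI : NoetherianSpace X := ι.isEmbedding.isInducing.noetherianSpace
    exact h k X (ι ≫ (Motives.projectiveSpace n k).hom) inferInstance inferInstance inferInstance
      inferInstance
  · intro h k _ _ X f hsep hft hqc hred
    exact hasResolution_of_forall_immersion_projectiveSpace (fun n X' ι hι hint => h k n X' ι hι hint)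
      X f

end Literature.AlgebraicGeometry.Resolution

end
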